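import Summits.CriticalPhenomena.PercolationContinuityZ3.Theorems.PercNearOneGluingNoHeavyRsw3InvasionWMSFNeighbours
import HarnessLib

/-!
# RSW3 lane (P2, gen 29): INVASION PERCOLATION XXXVIII-b — Lyons–Peres–Schramm 2006 PROPOSITION 3.4 (tree form), second half: the case of two finite strict clusters
# (`T(x) = T(y)`), `T(x) △ T(y)` finite for every WMSF bond and along WMSF paths; a.s. on `ℤ^d`

builds on p205010 (kernel theorem, internal audit signed; external expert review pending) — NOT used in this file.

Cell `prim-rsw3`, prover seat `prim-rsw3-p2` (gen 29), memo `run/shared/lean/prim/rsw3/P2-RSWLITE.md` §36.  Support file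
(`--supports stmt-CriticalPhenomena-4575`); no definitions, no named facts, no sorries.  Continuation of `…Rsw3InvasionWMSFNeighbours.lean` (strict-level tools, the mirror
lemma, the infinite-cluster case).

* **`treeEdges_subset_of_ltClusters_finite`** — both strict clusters finite ⇒ `T(x) ⊆ T(y)` (hence `=` by symmetry): `x` fills `C(x)`, exits through `e`, mirrors `y`'s
  filling of `C(y)`; `y` symmetrically; the two invasions MERGE at time `|C(x)| + |C(y)| - 1` and absorb the same bonds in a different order before that.
* **`treeEdges_symmDiff_finite_of_least_boundary`**, **`treeEdges_symmDiff_finite_of_mem_wmsf`** — LPS06 Prop. 3.4 (tree form, adjacent case): `s(x, y) ∈ 𝔉_w(U)` ⇒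
  `T_U(x) △ T_U(y)` finite (injective labels, every infinite connected locally finite graph); `treeEdges_symmDiff_finite_of_wmsf_reachable` along WMSF paths.
* `ae_treeEdges_symmDiff_finite_of_wmsf_reachable` — `ℤ^d`, a.s. (labels a.s. injective).

References: R. Lyons, Y. Peres, O. Schramm, Ann. Probab. 34 (2006) 1665–1692, Prop. 3.4 [LyonsPeresSchramm2006].
-/

noncomputable section

namespace Summit.CriticalPhenomena.PercolationContinuityZ3.Theorems.Rsw3

open Finset Filter MeasureTheory Literature.Probability.LatticeModels Literature.Probability.Percolation Literature.Probability.Percolation.Invasion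

section General

variable {V : Type*} [DecidableEq V] {G : SimpleGraph V} [G.LocallyFinite]

/-- **Case "both clusters finite"**: `T(x) ⊆ T(y)` (and by symmetry `T(x) = T(y)`).  (Injective labels; `C_{<U e}(x)`, `C_{<U e}(y)` finite of sizes `c + 1`, `c' + 1`,
`y ∉ C_{<U e}(x)`, `x ∉ C_{<U e}(y)`.) [cite: LyonsPeresSchramm2006, Prop. 3.4 (proof: "invasion from each x and y will fill C(x) ∪ C(y) ∪ {e} before invading elsewhere")] -/
theorem treeEdges_subset_of_ltClusters_finite [Infinite V] (hG : G.Preconnected) {U : Sym2 V → ℝ} (hU : Function.Injective U) {x y : V}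
    (hxy : G.Adj x y) (hyx : y ∉ openCluster {f : Sym2 V | f ∈ G.edgeSet ∧ U f < U s(x, y)} x)
    (hxy' : x ∉ openCluster {f : Sym2 V | f ∈ G.edgeSet ∧ U f < U s(x, y)} y) {c c' : ℕ}
    (hfin : (openCluster {f : Sym2 V | f ∈ G.edgeSet ∧ U f < U s(x, y)} x).Finite) (hcard : hfin.toFinset.card = c + 1)
    (hfin' : (openCluster {f : Sym2 V | f ∈ G.edgeSet ∧ U f < U s(x, y)} y).Finite) (hcard' : hfin'.toFinset.card = c' + 1) :
    treeEdges G U x ⊆ treeEdges G U y := by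
  have hyxadj : G.Adj y x := hxy.symm
  have hsw : U s(y, x) = U s(x, y) := by rw [Sym2.eq_swap]
  have hI := coe_invasion_eq_ltCluster hG hfin hcard
  have hJ := coe_invasion_eq_ltCluster hG hfin' hcard'
  have hexit := newDart_ltCluster_exit hG hU hxy hyx hfin hcard
  have hexit' : newDart G U (invasion G U y c') = some (y, x) := by
    have h1 : x ∉ openCluster {f : Sym2 V | f ∈ G.edgeSet ∧ U f < U s(y, x)} y := by rw [hsw]; exact hxy'
    have h2 : (openCluster {f : Sym2 V | f ∈ G.edgeSet ∧ U f < U s(y, x)} y).Finite := by rw [hsw]; exact hfin'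
    have h3 : h2.toFinset.card = c' + 1 := by
      rw [← hcard']
      congr 1
      exact Set.Finite.toFinset_inj.2 (by rw [hsw])
    exact newDart_ltCluster_exit hG hU hyxadj h1 h2 h3
  -- labels before the exits are `< U e`
  have hxlt : ∀ k < c, ∃ b, newDart G U (invasion G U x k) = some b ∧ U s(b.1, b.2) < U s(x, y) := by
    intro k hk
    obtain ⟨b, hb⟩ := exists_newDart_eq_some (U := U) (boundaryDarts_invasion_nonempty hG U x k)
    refine ⟨b, hb, ?_⟩
    rw [← acceptedLabel_of_eq_some G hb]
    exact (invasion_subset_ltCluster_and_lt hG hfin hcard c le_rfl).2 k hk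
  have hylt : ∀ k < c', ∃ b, newDart G U (invasion G U y k) = some b ∧ U s(b.1, b.2) < U s(x, y) := by
    intro k hk
    obtain ⟨b, hb⟩ := exists_newDart_eq_some (U := U) (boundaryDarts_invasion_nonempty hG U y k)
    refine ⟨b, hb, ?_⟩
    rw [← acceptedLabel_of_eq_some G hb]
    exact (invasion_subset_ltCluster_and_lt hG hfin' hcard' c' le_rfl).2 k hk
  -- outgoing bonds of the two filled clusters have labels `≥ U e`
  have hD : ∀ d ∈ invasion G U x c, ∀ w, w ∉ invasion G U x c → G.Adj d w → U s(x, y) ≤ U s(d, w) := by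
    intro d hd w hw hadj
    exact le_label_of_mem_ltCluster_of_not_mem (hI ▸ Finset.mem_coe.2 hd) (fun h => hw (Finset.mem_coe.1 (hI.symm ▸ h))) hadj
  have hD' : ∀ d ∈ invasion G U y c', ∀ w, w ∉ invasion G U y c' → G.Adj d w → U s(x, y) ≤ U s(d, w) := by
    intro d hd w hw hadj
    exact le_label_of_mem_ltCluster_of_not_mem (hJ ▸ Finset.mem_coe.2 hd) (fun h => hw (Finset.mem_coe.1 (hJ.symm ▸ h))) hadj
  have hiterx : ∀ n, (step G U)^[n] (invasion G U x 0) = invasion G U x n := fun n => by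
    have := invasion_add_eq_iterate (G := G) U x 0 n
    rw [Nat.zero_add] at this
    exact this.symm
  have hitery : ∀ n, (step G U)^[n] (invasion G U y 0) = invasion G U y n := fun n => by
    have := invasion_add_eq_iterate (G := G) U y 0 n
    rw [Nat.zero_add] at this
    exact this.symm
  -- mirror 1: `x` after its exit follows `y`'s first `c'` steps
  have hDA : Disjoint (invasion G U x c) (invasion G U y 0) := by
    rw [invasion_zero, Finset.disjoint_singleton_right]
    exact fun h => hyx (hI ▸ Finset.mem_coe.2 h)
  have hA : ∀ k < c', ∃ b, newDart G U ((step G U)^[k] (invasion G U y 0)) = some b ∧ U s(b.1, b.2) < U s(x, y) := fun k hk => by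
    rw [hitery]; exact hylt k hk
  have hstartx : invasion G U x (c + 1) = invasion G U x c ∪ invasion G U y 0 := by
    rw [invasion_succ_of_newDart hexit, invasion_zero, Finset.union_comm, ← Finset.insert_eq]
  have hm1 : ∀ n, n ≤ c' → invasion G U x (c + 1 + n) = invasion G U x c ∪ invasion G U y n ∧
      (n < c' → newDart G U (invasion G U x (c + 1 + n)) = newDart G U (invasion G U y n)) := by
    intro n hn
    obtain ⟨heq, -, hdart⟩ := iterate_step_union hU hD hDA hA n hn
    rw [hitery] at heq hdart
    have hxn : invasion G U x (c + 1 + n) = invasion G U x c ∪ invasion G U y n := by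
      rw [invasion_add_eq_iterate, hstartx, heq]
    exact ⟨hxn, fun h => by rw [hxn]; exact hdart h⟩
  -- mirror 2: `y` after its exit follows `x`'s first `c` steps
  have hDA' : Disjoint (invasion G U y c') (invasion G U x 0) := by
    rw [invasion_zero, Finset.disjoint_singleton_right]
    exact fun h => hxy' (hJ ▸ Finset.mem_coe.2 h)
  have hA' : ∀ k < c, ∃ b, newDart G U ((step G U)^[k] (invasion G U x 0)) = some b ∧ U s(b.1, b.2) < U s(x, y) := fun k hk => by
    rw [hiterx]; exact hxlt k hk
  have hstarty : invasion G U y (c' + 1) = invasion G U y c' ∪ invasion G U x 0 := by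
    rw [invasion_succ_of_newDart hexit', invasion_zero, Finset.union_comm, ← Finset.insert_eq]
  have hm2 : ∀ n, n ≤ c → invasion G U y (c' + 1 + n) = invasion G U y c' ∪ invasion G U x n ∧
      (n < c → newDart G U (invasion G U y (c' + 1 + n)) = newDart G U (invasion G U x n)) := by
    intro n hn
    obtain ⟨heq, -, hdart⟩ := iterate_step_union hU hD' hDA' hA' n hn
    rw [hiterx] at heq hdart
    have hyn : invasion G U y (c' + 1 + n) = invasion G U y c' ∪ invasion G U x n := by
      rw [invasion_add_eq_iterate, hstarty, heq]
    exact ⟨hyn, fun h => by rw [hyn]; exact hdart h⟩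
  -- merge at time `c + c' + 1`
  have hmerge : invasion G U x (c + c' + 1) = invasion G U y (c + c' + 1) := by
    have h1 := (hm1 c' le_rfl).1
    have h2 := (hm2 c le_rfl).1
    rw [show c + c' + 1 = c + 1 + c' by omega, h1, show c + 1 + c' = c' + 1 + c by omega, h2, Finset.union_comm]
  -- now compare tree edges by absorption time
  intro e he
  obtain ⟨k, a, ha, hae⟩ := (mem_treeEdges G).1 he
  rcases Nat.lt_or_ge k c with hk | hk
  · -- before `x`'s exit: mirrored by `y` at time `c' + 1 + k`
    refine (mem_treeEdges G).2 ⟨c' + 1 + k, a, ?_, hae⟩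
    rw [((hm2 k hk.le).2 hk)]; exact ha
  rcases hk.lt_or_eq with hk | rfl
  · rcases Nat.lt_or_ge k (c + c' + 1) with hk2 | hk2
    · -- strictly between the exit and the merge: mirrored by `y` at time `k - (c + 1)`
      obtain ⟨n, rfl⟩ : ∃ n, k = c + 1 + n := ⟨k - (c + 1), by omega⟩
      refine (mem_treeEdges G).2 ⟨n, a, ?_, hae⟩
      rw [← (hm1 n (by omega)).2 (by omega)]; exact ha
    · -- after the merge
      obtain ⟨n, rfl⟩ : ∃ n, k = c + c' + 1 + n := ⟨k - (c + c' + 1), by omega⟩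
      refine (mem_treeEdges G).2 ⟨c + c' + 1 + n, a, ?_, hae⟩
      rw [← invasion_eq_of_eq hmerge n]; exact ha
  · -- the exit bond `e` itself: absorbed by `y` at time `c'`
    rw [hexit] at ha
    obtain rfl : (x, y) = a := Option.some_injective _ ha
    exact (mem_treeEdges G).2 ⟨c', (y, x), hexit', by rw [← hae]; exact Sym2.eq_swap⟩

/-- **LPS06 PROPOSITION 3.4 (tree form, adjacent case).**  Injective labels, `G` infinite connected locally finite, `e = s(x, y)` the strictly least boundary bond of a
finite `W ∋ x`, `y ∉ W` (so `e ∈ 𝔉_w`): the symmetric difference `T_U(x) △ T_U(y)` is FINITE — indeed either `T(x) = T(y)`, or `T(y) ⊆ T(x)` with the difference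
among the first `|C_{<U e}(x)|` bonds of `x`. [cite: LyonsPeresSchramm2006, Prop. 3.4] -/
theorem treeEdges_symmDiff_finite_of_least_boundary [Infinite V] (hG : G.Preconnected) {U : Sym2 V → ℝ} (hU : Function.Injective U) {W : Finset V}
    {x y : V} (hx : x ∈ W) (hy : y ∉ W) (hxy : G.Adj x y) (hmin : ∀ b ∈ boundaryDarts G W, s(b.1, b.2) ≠ s(x, y) → U s(x, y) < U s(b.1, b.2)) :
    (symmDiff (treeEdges G U x) (treeEdges G U y)).Finite := by
  have hsubW := ltCluster_subset_of_least_boundary hx hmin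
  have hfin : (openCluster {f : Sym2 V | f ∈ G.edgeSet ∧ U f < U s(x, y)} x).Finite := W.finite_toSet.subset hsubW
  have hyx : y ∉ openCluster {f : Sym2 V | f ∈ G.edgeSet ∧ U f < U s(x, y)} x := fun h => hy (Finset.mem_coe.1 (hsubW h))
  obtain ⟨c, hc⟩ : ∃ c, hfin.toFinset.card = c + 1 :=
    Nat.exists_eq_succ_of_ne_zero (Finset.card_ne_zero.2 ⟨x, hfin.mem_toFinset.2 (mem_openCluster_self _ _)⟩)
  by_cases hinf : (openCluster {f : Sym2 V | f ∈ G.edgeSet ∧ U f < U s(x, y)} y).Infinite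
  · obtain ⟨-, hsub, hdiff⟩ := treeEdges_of_ltCluster_infinite hG hU hxy hyx hfin hc hinf
    have hfinE : {e : Sym2 V | ∃ k, k ≤ c ∧ ∃ a : V × V, newDart G U (invasion G U x k) = some a ∧ s(a.1, a.2) = e}.Finite := by
      refine (Set.finite_range fun k : Fin (c + 1) => (newDart G U (invasion G U x k)).elim s(x, x) fun a => s(a.1, a.2)).subset ?_
      rintro e ⟨k, hk, a, ha, hae⟩
      exact ⟨⟨k, Nat.lt_succ_of_le hk⟩, by simp only [ha, Option.elim_some, hae]⟩
    refine (hfinE.subset ?_)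
    intro e he
    rcases (Set.mem_symmDiff).1 he with h | h
    · exact hdiff ⟨h.1, h.2⟩
    · exact absurd (hsub h.1) h.2
  · rw [Set.not_infinite] at hinf
    have hxy' : x ∉ openCluster {f : Sym2 V | f ∈ G.edgeSet ∧ U f < U s(x, y)} y :=
      fun h => hyx (SimpleGraph.Reachable.symm h)
    obtain ⟨c', hc'⟩ : ∃ c', hinf.toFinset.card = c' + 1 :=
      Nat.exists_eq_succ_of_ne_zero (Finset.card_ne_zero.2 ⟨y, hinf.mem_toFinset.2 (mem_openCluster_self _ _)⟩)
    have h1 := treeEdges_subset_of_ltClusters_finite hG hU hxy hyx hxy' hfin hc hinf hc'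
    -- symmetric application
    have hsw : U s(y, x) = U s(x, y) := by rw [Sym2.eq_swap]
    have hfin2 : (openCluster {f : Sym2 V | f ∈ G.edgeSet ∧ U f < U s(y, x)} y).Finite := by rw [hsw]; exact hinf
    have hfin2' : (openCluster {f : Sym2 V | f ∈ G.edgeSet ∧ U f < U s(y, x)} x).Finite := by rw [hsw]; exact hfin
    have h2 := treeEdges_subset_of_ltClusters_finite hG hU hxy.symm (by rw [hsw]; exact hxy') (by rw [hsw]; exact hyx) hfin2
      (by rw [← hc']; congr 1; exact Set.Finite.toFinset_inj.2 (by rw [hsw])) hfin2'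
      (by rw [← hc]; congr 1; exact Set.Finite.toFinset_inj.2 (by rw [hsw]))
    have heq : treeEdges G U x = treeEdges G U y := Set.Subset.antisymm h1 h2
    rw [heq, symmDiff_self]
    exact Set.finite_empty

/-- **LPS06 Prop. 3.4 for the endpoints of a WMSF bond** (injective labels): if `s(x, y) ∈ 𝔉_w(U)` then `T_U(x) △ T_U(y)` is finite.
[cite: LyonsPeresSchramm2006, Prop. 3.4] -/
theorem treeEdges_symmDiff_finite_of_mem_wmsf [Infinite V] (hG : G.Preconnected) {U : Sym2 V → ℝ} (hU : Function.Injective U) {x y : V}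
    (he : s(x, y) ∈ wmsf G U) : (symmDiff (treeEdges G U x) (treeEdges G U y)).Finite := by
  obtain ⟨W, a, haW, hae, hmin⟩ := he
  obtain ⟨ha1, ha2, hadj⟩ := (mem_boundaryDarts G).1 haW
  have hmin' : ∀ b ∈ boundaryDarts G W, s(b.1, b.2) ≠ s(a.1, a.2) → U s(a.1, a.2) < U s(b.1, b.2) := by
    intro b hb hne; rw [hae] at hne ⊢; exact hmin b hb hne
  have key := treeEdges_symmDiff_finite_of_least_boundary hG hU ha1 ha2 hadj hmin'
  rcases Sym2.eq_iff.1 hae with ⟨h1, h2⟩ | ⟨h1, h2⟩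
  · rw [h1, h2] at key; exact key
  · rw [h1, h2] at key; rw [symmDiff_comm]; exact key

/-- **LPS06 Prop. 3.4 along WMSF paths**: vertices joined by a path of WMSF bonds have invasion trees with finite symmetric difference.
[cite: LyonsPeresSchramm2006, Prop. 3.4] -/
theorem treeEdges_symmDiff_finite_of_wmsf_reachable [Infinite V] (hG : G.Preconnected) {U : Sym2 V → ℝ} (hU : Function.Injective U) {x y : V}
    (h : (SimpleGraph.fromEdgeSet (wmsf G U)).Reachable x y) : (symmDiff (treeEdges G U x) (treeEdges G U y)).Finite := by
  obtain ⟨p⟩ := h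
  induction p with
  | nil => rw [symmDiff_self]; exact Set.finite_empty
  | @cons u v w huv _ ih =>
    have he : s(u, v) ∈ wmsf G U := ((SimpleGraph.fromEdgeSet_adj _).1 huv).1
    have h1 := treeEdges_symmDiff_finite_of_mem_wmsf hG hU he
    exact (h1.union ih).subset (symmDiff_triangle _ _ _)

end General

/-! ## §4 `ℤ^d` -/

variable {d : ℕ}

/-- **On `ℤ^d` (`d ≥ 1`), a.s.: any two vertices joined by a path of WMSF bonds have invasion trees differing in finitely many bonds** (LPS06 Prop. 3.4; labels a.s.
injective). [cite: LyonsPeresSchramm2006, Prop. 3.4] -/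
theorem ae_treeEdges_symmDiff_finite_of_wmsf_reachable (hd : 1 ≤ d) :
    ∀ᵐ U ∂(labelMeasure (Site d)), ∀ x y : Site d, (SimpleGraph.fromEdgeSet (wmsf (zdGraph d) U)).Reachable x y →
      (symmDiff (treeEdges (zdGraph d) U x) (treeEdges (zdGraph d) U y)).Finite := by
  haveI : Nonempty (Fin d) := ⟨⟨0, hd⟩⟩
  haveI : Infinite (Site d) := Pi.infinite_of_right
  filter_upwards [Literature.Barriers.CriticalPhenomena.ae_injective_labelMeasure (V := Site d)] with U hU
  intro x y h
  exact treeEdges_symmDiff_finite_of_wmsf_reachable zdGraph_preconnected_holds hU h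

end Summit.CriticalPhenomena.PercolationContinuityZ3.Theorems.Rsw3
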